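import Summits.Ventures.HodgeRepro.FaceCensusEngine
import Summits.Ventures.HodgeRepro.CayleyTable

/-!
# Single-class `SumTwo` quadruples of EVERY pattern carry a conjugate pair — the engine check

Blind re-derivation cell `pub-hodge-repro`, seat `typer` (gen 5).  Sits on the sealer's census engine
(`FaceCensusEngine.lean`: CM types as bit-masks `T < 2 ^ n`, `Γ.twist j` = the Galois twist / right
translation `T ↦ T·g_j`) and on `CayleyTable.lean` (the concrete groups of `Groups.lean` as tables).

`SingleClass.lean` / `SingleClass12*.lean` prove that no FACE `(Φ; π, π′)` — a `SumTwo` quadruple of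
pairing pattern `(n/2 − 2, 1, 1)` — is *single-class* (all four corners Galois twists of one CM type,
so that the corner product is a power of ONE simple CM variety).  In degree 12 there are `SumTwo`
quadruples of the patterns `(3,2,1)` and `(2,2,2)` which are not faces (ROUTE.md §3.4;
`FaceCriterion.lean`), and ROUTE.md §3.4 asserts that none of them is single-class either.  This file
turns that sentence into a closed `Bool` computation on ANY Cayley table `Γ`, using that in a `SumTwo`
quadruple `[T, A, B, D]` the fourth corner is DETERMINED by the first three (`requiredD`: an
embedding of `T` lies in `D` iff in neither `A` nor `B`, an embedding outside `T` iff in exactly one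
of `A`, `B`), so only PAIRS of twists have to be enumerated:

* `noSingleClassSumTwo Γ` — for every CM type `T` of `Γ` and every two twists `A = T·a`, `B = T·b`:
  if `(T, A, B)` can be completed (`validAB`) and the forced completion `requiredD` is again a
  twist of `T`, then some corner of `[T, A, B, requiredD]` is the conjugate (complement mask) of
  another (`hasConjPair`);
* `hasConjPair_of_sumTwo` — if the check passes, then EVERY `SumTwo` quadruple `[T, T·a, T·b, T·d]`
  of twists of a CM type `T` has a conjugate pair (bitwise reasoning, no enumeration);
* the rows `noSingleClassSumTwo_<table> = true` by kernel `decide` for the tables of order 12 are in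
  `QuadRows12.lean`; the transfer to the `Finset` vocabulary of `CMType.lean` / `Faces.lean`
  (`IsSingleClass`, `SumTwo`) is `QuadFinset.lean`.
-/

set_option autoImplicit false

open Summit.Ventures.HodgeRepro.FaceCensus

namespace HodgeRepro

namespace QuadEngine

variable {n : ℕ}

/-! ### The check -/

/-- The full mask `2 ^ n − 1` (all `n` embeddings). -/
def full (n : ℕ) : ℕ := 2 ^ n - 1

/-- `SumTwo` for a list of corner masks: every embedding lies in exactly two of them. -/
def sumTwoMasks (n : ℕ) (L : List ℕ) : Bool :=
  (List.finRange n).all fun i => (L.filter fun T => mem i T).length == 2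

/-- Some corner is the complement mask — for CM types, the conjugate type — of another. -/
def hasConjPair (n : ℕ) (L : List ℕ) : Bool := L.any fun T => L.contains (full n ^^^ T)

/-- `(T, A, B)` can be completed to a `SumTwo` quadruple: no embedding of `T` lies in both `A` and
`B`, and every embedding outside `T` lies in at least one of them. -/
def validAB (n : ℕ) (T A B : ℕ) : Bool :=
  (T &&& A &&& B == 0) && ((full n ^^^ T) &&& (full n ^^^ (A ||| B)) == 0)

/-- The fourth corner forced by `SumTwo`: an embedding of `T` lies in it iff in neither `A` nor `B`;
an embedding outside `T` iff in exactly one of `A`, `B`. -/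
def requiredD (n : ℕ) (T A B : ℕ) : ℕ :=
  (T &&& (full n ^^^ (A ||| B))) ||| ((full n ^^^ T) &&& (A ^^^ B))

/-- The check for one CM type `T` with the list `tw` of its twists. -/
def checkType (n : ℕ) (T : ℕ) (tw : List ℕ) : Bool :=
  tw.all fun A => tw.all fun B =>
    !(validAB n T A B && tw.contains (requiredD n T A B)) ||
      hasConjPair n [T, A, B, requiredD n T A B]

/-- **The check** over every CM type of the table and its `n` twists. -/
def noSingleClassSumTwo (Γ : CMGaloisType n) : Bool :=
  Γ.cmTypes.all fun T => checkType n T ((List.finRange n).map fun j => Γ.twist j T)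

/-! ### Bounds and membership for the engine's masks -/

/-- A singleton mask is a mask. -/
theorem bit_lt (i : Fin n) : (bit i : ℕ) < 2 ^ n :=
  Nat.pow_lt_pow_right (by norm_num) i.isLt

/-- Images of masks are masks: `imageMask f T < 2 ^ n` (same proof as `EngineComplete.imageMask_lt`,
restated here so that this file does not depend on p2's bridge). -/
theorem imageMask_lt (f : Fin n → Fin n) (T : ℕ) : imageMask f T < 2 ^ n := by
  unfold imageMask
  suffices h : ∀ (l : List (Fin n)) (acc : ℕ), acc < 2 ^ n →
      l.foldl (fun acc i => if mem i T then acc ||| bit (f i) else acc) acc < 2 ^ n from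
    h _ 0 (Nat.two_pow_pos n)
  intro l
  induction l with
  | nil => intro acc h; simpa using h
  | cons i l ih =>
    intro acc h
    rw [List.foldl_cons]
    apply ih
    split_ifs
    · exact Nat.or_lt_two_pow h (bit_lt (f i))
    · exact h

/-- A twist of a mask is a mask. -/
theorem twist_lt (Γ : CMGaloisType n) (j : Fin n) (T : ℕ) : Γ.twist j T < 2 ^ n :=
  imageMask_lt _ _

/-- Membership in a singleton mask. -/
theorem mem_bit (i j : Fin n) : mem i (bit j) = true ↔ i = j := by
  simp only [mem, bit, Nat.testBit_two_pow, decide_eq_true_eq]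
  exact ⟨fun h => (Fin.ext h).symm, fun h => congrArg Fin.val h.symm⟩

/-- Membership in an image mask (the foldl invariant; same shape as p2's
`EngineBridge.mem_imageMask`). -/
theorem mem_imageMask (f : Fin n → Fin n) (T : ℕ) (k : Fin n) :
    mem k (imageMask f T) = true ↔ ∃ i, mem i T = true ∧ f i = k := by
  unfold imageMask
  suffices H : ∀ (l : List (Fin n)) (acc : ℕ),
      mem k (l.foldl (fun acc i => if mem i T then acc ||| bit (f i) else acc) acc) = true ↔
        (mem k acc = true ∨ ∃ i ∈ l, mem i T = true ∧ f i = k) by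
    rw [H]
    simp [mem, List.mem_finRange]
  intro l
  induction l with
  | nil => intro acc; simp
  | cons a l ih =>
    intro acc
    simp only [List.foldl_cons, List.mem_cons]
    rw [ih]
    by_cases ha : mem a T = true
    · simp only [ha, if_true]
      have : mem k (acc ||| bit (f a)) = true ↔ (mem k acc = true ∨ k = f a) := by
        simp only [mem, Nat.testBit_or, Bool.or_eq_true]
        rw [← mem, ← mem, mem_bit]
      rw [this]
      constructor
      · rintro ((h | h) | ⟨i, hi, hiT, hik⟩)
        · exact Or.inl h
        · exact Or.inr ⟨a, Or.inl rfl, ha, h.symm⟩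
        · exact Or.inr ⟨i, Or.inr hi, hiT, hik⟩
      · rintro (h | ⟨i, (rfl | hi), hiT, hik⟩)
        · exact Or.inl (Or.inl h)
        · exact Or.inl (Or.inr hik.symm)
        · exact Or.inr ⟨i, hi, hiT, hik⟩
    · simp only [ha]
      constructor
      · rintro (h | ⟨i, hi, hiT, hik⟩)
        · exact Or.inl h
        · exact Or.inr ⟨i, Or.inr hi, hiT, hik⟩
      · rintro (h | ⟨i, (rfl | hi), hiT, hik⟩)
        · exact Or.inl h
        · exact absurd hiT ha
        · exact Or.inr ⟨i, hi, hiT, hik⟩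

/-- A twist of `T` is in the list of twists of `T`. -/
theorem twist_mem_twists (Γ : CMGaloisType n) (T : ℕ) (j : Fin n) :
    Γ.twist j T ∈ (List.finRange n).map fun k => Γ.twist k T :=
  List.mem_map.2 ⟨j, List.mem_finRange j, rfl⟩

/-- Members of `Γ.cmTypes` are masks. -/
theorem lt_of_mem_cmTypes {Γ : CMGaloisType n} {T : ℕ} (h : T ∈ Γ.cmTypes) : T < 2 ^ n := by
  unfold CMGaloisType.cmTypes at h
  rw [List.mem_filter, List.mem_range] at h
  exact h.1

/-! ### Bitwise content of `SumTwo` -/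

/-- `SumTwo` on four Booleans: no embedding of `T` in both `A` and `B`; every embedding outside `T`
in one of them; and the fourth bit is forced. -/
theorem bits_of_count (t a b d : Bool)
    (h : (([t, a, b, d].filter id).length == 2) = true) :
    (t && a && b) = false ∧ (!t && !(a || b)) = false ∧
      d = ((t && !(a || b)) || (!t && (a ^^ b))) := by
  revert t a b d
  decide

/-- `sumTwoMasks` read at one embedding. -/
theorem count_of_sumTwoMasks {L : List ℕ} (h : sumTwoMasks n L = true) (i : Fin n) :
    ((L.filter fun T => mem i T).length == 2) = true := by
  unfold sumTwoMasks at h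
  rw [List.all_eq_true] at h
  exact h i (List.mem_finRange i)

/-- The corner count at `i` of a four-list of masks is the count of the four bits. -/
theorem length_filter_four (i : Fin n) (T A B D : ℕ) :
    ([T, A, B, D].filter fun X => mem i X).length =
      ([mem i T, mem i A, mem i B, mem i D].filter id).length := by
  have e : [mem i T, mem i A, mem i B, mem i D] = [T, A, B, D].map (mem i) := rfl
  rw [e, List.filter_map, List.length_map]
  rfl

/-- The bit facts of a `SumTwo` quadruple at an embedding `i`. -/
theorem bit_facts {T A B D : ℕ} (h : sumTwoMasks n [T, A, B, D] = true) (i : Fin n) :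
    (mem i T && mem i A && mem i B) = false ∧ (!mem i T && !(mem i A || mem i B)) = false ∧
      mem i D = ((mem i T && !(mem i A || mem i B)) || (!mem i T && (mem i A ^^ mem i B))) := by
  have h1 := count_of_sumTwoMasks h i
  rw [length_filter_four] at h1
  exact bits_of_count _ _ _ _ h1

/-- Bits at or beyond `n` of a mask are `false`. -/
theorem testBit_eq_false_of_le {X i : ℕ} (hX : X < 2 ^ n) (hi : n ≤ i) : X.testBit i = false :=
  Nat.testBit_lt_two_pow (lt_of_lt_of_le hX (Nat.pow_le_pow_right (by norm_num) hi))

/-- Bits of the full mask. -/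
theorem testBit_full (i : ℕ) : (full n).testBit i = decide (i < n) :=
  Nat.testBit_two_pow_sub_one n i

/-- **The fourth corner is forced.**  If `[T, A, B, D]` (masks) is `SumTwo`, then `(T, A, B)` is
valid and `D = requiredD n T A B`. -/
theorem requiredD_eq_of_sumTwo {T A B D : ℕ} (hT : T < 2 ^ n) (hA : A < 2 ^ n) (hB : B < 2 ^ n)
    (hD : D < 2 ^ n) (h : sumTwoMasks n [T, A, B, D] = true) :
    validAB n T A B = true ∧ D = requiredD n T A B := by
  have key : ∀ i : ℕ,
      (T.testBit i && A.testBit i && B.testBit i) = false ∧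
      (((full n).testBit i ^^ T.testBit i) && ((full n).testBit i ^^ (A ||| B).testBit i)) = false ∧
      D.testBit i = ((T.testBit i && ((full n).testBit i ^^ (A ||| B).testBit i)) ||
        (((full n).testBit i ^^ T.testBit i) && (A.testBit i ^^ B.testBit i))) := by
    intro i
    by_cases hi : i < n
    · obtain ⟨h1, h2, h3⟩ := bit_facts h ⟨i, hi⟩
      simp only [mem] at h1 h2 h3
      rw [testBit_full, Nat.testBit_or]
      simp only [hi, decide_true, Bool.true_xor]
      exact ⟨h1, h2, h3⟩
    · have hi' : n ≤ i := Nat.le_of_not_lt hi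
      rw [testBit_full, Nat.testBit_or, testBit_eq_false_of_le hT hi', testBit_eq_false_of_le hA hi',
        testBit_eq_false_of_le hB hi', testBit_eq_false_of_le hD hi']
      simp [hi]
  refine ⟨?_, ?_⟩
  · unfold validAB
    rw [Bool.and_eq_true, beq_iff_eq, beq_iff_eq]
    constructor
    · apply Nat.eq_of_testBit_eq
      intro i
      rw [Nat.testBit_and, Nat.testBit_and, Nat.zero_testBit]
      exact (key i).1
    · apply Nat.eq_of_testBit_eq
      intro i
      rw [Nat.testBit_and, Nat.testBit_xor, Nat.testBit_xor, Nat.zero_testBit]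
      exact (key i).2.1
  · apply Nat.eq_of_testBit_eq
    intro i
    unfold requiredD
    rw [Nat.testBit_or, Nat.testBit_and, Nat.testBit_and, Nat.testBit_xor, Nat.testBit_xor,
      Nat.testBit_xor]
    exact (key i).2.2

/-! ### The check implies the statement -/

/-- **If the check passes, every `SumTwo` quadruple of twists of a CM type has a conjugate pair.** -/
theorem hasConjPair_of_sumTwo (Γ : CMGaloisType n) (hΓ : noSingleClassSumTwo Γ = true)
    {T : ℕ} (hT : T ∈ Γ.cmTypes) (a b d : Fin n)
    (hs : sumTwoMasks n [T, Γ.twist a T, Γ.twist b T, Γ.twist d T] = true) :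
    hasConjPair n [T, Γ.twist a T, Γ.twist b T, Γ.twist d T] = true := by
  unfold noSingleClassSumTwo at hΓ
  rw [List.all_eq_true] at hΓ
  have h1 := hΓ T hT
  unfold checkType at h1
  rw [List.all_eq_true] at h1
  have h2 := h1 _ (twist_mem_twists Γ T a)
  rw [List.all_eq_true] at h2
  have h3 := h2 _ (twist_mem_twists Γ T b)
  obtain ⟨hv, hD⟩ := requiredD_eq_of_sumTwo (lt_of_mem_cmTypes hT) (twist_lt Γ a T)
    (twist_lt Γ b T) (twist_lt Γ d T) hs
  rw [← hD] at h3
  have hc : ((List.finRange n).map fun k => Γ.twist k T).contains (Γ.twist d T) = true :=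
    List.contains_iff_mem.2 (twist_mem_twists Γ T d)
  rw [hv, hc] at h3
  simpa using h3

end QuadEngine

end HodgeRepro
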